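import Mathlib
import Literature.Computability.MetaComplexity.SearchMCSPLightConeLowerBound
import Literature.Computability.MetaComplexity.ZeroErrorMCSPJuntaLowerBound
import HarnessLib

/-!
# `search-MCSP[s]` against FORMULAS and BRANCHING PROGRAMS of sublinear size: the junta form of
the light-cone bound (rows R52 items 3–5 of the gap census), proved in-tree

Chen–Jin–Williams (FOCS 2019, Thm. 1.6 items 3–5) magnify, for `s` in the regime
`m ≤ s(m) ≤ 2^{(1-Ω(1))m}`, the hypotheses "`search-MCSP[s(m)]` has no `B₂`-formulas with
`n² · poly(s(m))` leaves", "no `U₂`-formulas with `n³ · poly(s(m))` leaves", "no branching programs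
of size `n² · poly(s(m))`" (`n = N = 2^m` the input length) into `PSPACE ⊄ Formula[poly]` /
`PSPACE ⊄ BP[poly]`. The census (`MagnificationGapCensus.lean`, `gap_R52_b2Formula`,
`gap_R52_formula`, `gap_R52_bp`) records items 3 and 5 as T-ONLY (no `MCSP`-specific bound in print
in the model) and item 4 as COMPARABLE through print's `n^{2-δ}` formula bound.

`SearchMCSPLightConeLowerBound.lean` proved the KNOWN side of item 1 (general `B₂` circuits) from
the light cone of output bit `0` (the decision indicator, `sliceFn_mem_of_searchMCSPSolvableAt`).
This file states the argument once for every class of JUNTAS and instantiates it at the three device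
classes of items 3–5, which are juntas by their light cones: a `B₂`- or De Morgan formula with `ℓ`
leaves reads `≤ ℓ` inputs (`b2FormulaFns_junta`, `deMorganFormulaFns_junta`), a branching program
with `t` inner nodes queries `≤ t` variables (`bpFns_junta`, from `bp_eval_congr`).

* `two_pow_le_circuitCount_of_junta_eq_sliceFn` — if the indicator of `MCSP[s] ∩ {0,1}^{2^m}` is an
  `S`-junta (`m ≥ 1`), then `2^{2^m - |S|} ≤ (s+1)(16(m+s+1)²)^s(m+s+1)` (`s = s(m)`): the cylinder
  of the projection's truth table over `S` consists of YES instances.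
* `not_searchMCSPSolvableAt_of_junta` — hence `search-MCSP[s]` is not solved at `m` by output
  functions from any class of `K`-juntas once the count is `< 2^{2^m - K}`.
* `searchMCSP_b2Formula_known_sublinear`, `searchMCSP_formula_known_sublinear`,
  `searchMCSP_bp_known_sublinear` — for every `s` in the regime of Thm. 1.6 there is `β₀ < 1` with:
  for all `β' ∈ (β₀,1)`, `search-MCSP[s]` is NOT solved with `N - ⌈N^{β'}⌉` leaves (`B₂` or De
  Morgan) resp. inner nodes PER OUTPUT BIT at any large `m`. Items 3/5 NEED `N² · s(m)^k + k`, item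
  4 `N³ · s(m)^k + k`, for EVERY `k`: the same-model gap is the factor `N · poly(s)` resp.
  `N² · poly(s)` (`knownBudget_lt_searchBudget`-style comparison `searchKnown_lt_needed_sq`).

Formal content: light cones (a device reads only the variables in its light cone) and counting
[Jukna2012, §1.2]; nothing here is a named fact. For De Morgan formulas print knows MORE
(`MCSP[2^{√m}] ∉ Formula[N^{2-δ}]`, Hirahara–Santhanam CCC 2017, quoted in the census at
`gap_R52_formula`); this file does not reproduce it.
-/

namespace Literature.Computability.MetaComplexity.ChenJinWilliams2020

open Finset

/-- **Branching programs with `t` inner nodes are `t`-juntas**: two inputs agreeing on every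
queried variable follow the same path (`bp_eval_congr`). [folklore] -/
theorem bpFns_junta (t : ℕ → ℕ) (n : ℕ) :
    ∀ f ∈ bpFns t n, ∃ S : Finset (Fin n), S.card ≤ t n ∧
      ∀ x x' : Fin n → Bool, (∀ i ∈ S, x i = x' i) → f x = f x' := by
  rintro f ⟨P, hP, hPf⟩
  refine ⟨univ.image P.var, card_image_le.trans (by simpa [BranchingProgram.size] using hP),
    fun x x' h => ?_⟩
  rw [← hPf x, ← hPf x']
  exact bp_eval_congr P fun v => h _ (mem_image_of_mem _ (mem_univ v))

end Literature.Computability.MetaComplexity.ChenJinWilliams2020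

namespace Literature.Computability.MetaComplexity.ChenJinWilliams2019

open Finset Filter Topology
open Literature.Computability.Complexity Literature.Computability.Complexity.Circuit
open Literature.Computability.Complexity.CircuitCount
open Literature.Computability.MetaComplexity
open Literature.Computability.MetaComplexity.ChenJinWilliams2020

/-! ### The junta form of the light-cone bound for the decision slice -/

/-- **A junta computing the `MCSP[s]` indicator has a large YES cylinder.** If `m ≥ 1` and the
indicator of `MCSP[s] ∩ {0,1}^{2^m}` depends only on the coordinates in `S`, then
`2^{2^m - |S|} ≤ (s+1)(16(m+s+1)²)^s(m+s+1)` (`s = s(m)`): every truth table agreeing on `S` with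
the projection `w ↦ w₀` (complexity `0`) is accepted, hence has `B₂`-complexity `≤ s(m)`.
[folklore] -/
theorem two_pow_le_circuitCount_of_junta_eq_sliceFn {s : ℕ → ℕ} {m : ℕ} (hm : 1 ≤ m)
    {S : Finset (Fin (2 ^ m))}
    (hS : ∀ x x' : Fin (2 ^ m) → Bool, (∀ i ∈ S, x i = x' i) →
      sliceFn (MCSPSize s) (2 ^ m) x = sliceFn (MCSPSize s) (2 ^ m) x') :
    2 ^ (2 ^ m - S.card) ≤ (s m + 1) * (16 * (m + s m + 1) ^ 2) ^ s m * (m + s m + 1) := by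
  obtain ⟨k, rfl⟩ : ∃ k, m = k + 1 := ⟨m - 1, by omega⟩
  let e := boolFunEquivFin (k + 1)
  let tbl : (Fin (2 ^ (k + 1)) → Bool) → ((Fin (k + 1) → Bool) → Bool) := fun x w => x (e w)
  have htbl_inj : Function.Injective tbl := by
    intro x x' h
    funext i
    have := congrFun h (e.symm i)
    simpa [tbl, e] using this
  have htbl_tt : ∀ x, truthTable (tbl x) = List.ofFn x := by
    intro x
    simp [truthTable, tbl, e]
  have hslice : ∀ x : Fin (2 ^ (k + 1)) → Bool,
      sliceFn (MCSPSize s) (2 ^ (k + 1)) x = true ↔ circuitSizeOver B2 (tbl x) ≤ s (k + 1) := by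
    intro x
    rw [← truthTable_mem_MCSPSize_iff, htbl_tt]
    exact (Set.mem_iff_boolIndicator _ _).symm
  -- the YES instance `z`: the truth table of the projection `w ↦ w 0`
  let z : Fin (2 ^ (k + 1)) → Bool := fun i => (e.symm i) ⟨0, by omega⟩
  have htblz : tbl z = fun w => w ⟨0, by omega⟩ := by
    funext w
    simp [tbl, z, e]
  have hzsmall : circuitSizeOver B2 (tbl z) ≤ s (k + 1) := by
    rw [htblz]
    exact (circuitSizeOver_le_of_computes (f := fun v : Fin (k + 1) → Bool => v ⟨0, by omega⟩)
      (Circuit.input (⟨0, by omega⟩ : Fin (k + 1))) (fun g hg => by cases hg)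
        (fun _ => rfl)).trans (by simp)
  have hz : sliceFn (MCSPSize s) (2 ^ (k + 1)) z = true := (hslice z).2 hzsmall
  have hfib : ∀ x : Fin (2 ^ (k + 1)) → Bool, (∀ i ∈ S, x i = z i) →
      circuitSizeOver B2 (tbl x) ≤ s (k + 1) := fun x hx =>
    (hslice x).1 (by rw [hS x z hx, hz])
  calc 2 ^ (2 ^ (k + 1) - S.card)
      ≤ 2 ^ (Fintype.card (Fin (2 ^ (k + 1))) - S.card) :=
        Nat.pow_le_pow_right (by norm_num) (by simp only [Fintype.card_fin]; omega)
    _ ≤ #{x : Fin (2 ^ (k + 1)) → Bool | ∀ i ∈ S, x i = z i} := by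
        convert two_pow_le_card_filter_agree S z
    _ ≤ #{f : (Fin (k + 1) → Bool) → Bool | circuitSizeOver B2 f ≤ s (k + 1)} := by
        refine card_le_card_of_injOn tbl (fun x hx => ?_) htbl_inj.injOn
        simp only [coe_filter, Set.mem_setOf_eq, mem_univ, true_and] at hx ⊢
        exact hfib x hx
    _ ≤ _ := card_filter_circuitSizeOver_le (k + 1) (s (k + 1))

/-- **`search-MCSP[s]` vs juntas.** If every member of `𝒞(2^m)` is a `K`-junta (`m ≥ 1`) and the
circuit count at threshold `s(m)` is `< 2^{2^m - K}`, then `search-MCSP[s]` is not solved at `m` by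
output functions from `𝒞`: output `0` would be a `K`-junta computing the `MCSP[s]` indicator.
[folklore] -/
theorem not_searchMCSPSolvableAt_of_junta {s : ℕ → ℕ} {K m : ℕ} (hm : 1 ≤ m)
    {𝒞 : ∀ n : ℕ, Set ((Fin n → Bool) → Bool)}
    (h𝒞 : ∀ f ∈ 𝒞 (2 ^ m), ∃ S : Finset (Fin (2 ^ m)), S.card ≤ K ∧
      ∀ x x' : Fin (2 ^ m) → Bool, (∀ i ∈ S, x i = x' i) → f x = f x')
    (hcount : (s m + 1) * (16 * (m + s m + 1) ^ 2) ^ s m * (m + s m + 1) < 2 ^ (2 ^ m - K)) :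
    ¬ SearchMCSPSolvableAt 𝒞 s m := by
  intro hS
  obtain ⟨S, hSK, hSj⟩ := h𝒞 _ (sliceFn_mem_of_searchMCSPSolvableAt hS)
  have key := two_pow_le_circuitCount_of_junta_eq_sliceFn hm hSj
  have hmono : 2 ^ (2 ^ m - K) ≤ 2 ^ (2 ^ m - S.card) :=
    Nat.pow_le_pow_right (by norm_num) (by omega)
  exact absurd (hmono.trans key) (not_le.2 hcount)

/-! ### Items 3–5: `B₂`-formulas, De Morgan formulas, branching programs -/

/-- `search-MCSP[s]` is not solved at `m ≥ 1` with `B₂`-FORMULAS of `f(2^m)` leaves per output bit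
when the count at `s(m)` is `< 2^{2^m - f(2^m)}`. [folklore] -/
theorem not_searchMCSPSolvableAt_b2Formula {s f : ℕ → ℕ} {m : ℕ} (hm : 1 ≤ m)
    (h : (s m + 1) * (16 * (m + s m + 1) ^ 2) ^ s m * (m + s m + 1) < 2 ^ (2 ^ m - f (2 ^ m))) :
    ¬ SearchMCSPSolvableAt (b2FormulaFns f) s m :=
  not_searchMCSPSolvableAt_of_junta hm (b2FormulaFns_junta f (2 ^ m)) h

/-- The same for De Morgan (`U₂`) FORMULAS with `f(2^m)` leaves per output bit. [folklore] -/
theorem not_searchMCSPSolvableAt_formula {s f : ℕ → ℕ} {m : ℕ} (hm : 1 ≤ m)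
    (h : (s m + 1) * (16 * (m + s m + 1) ^ 2) ^ s m * (m + s m + 1) < 2 ^ (2 ^ m - f (2 ^ m))) :
    ¬ SearchMCSPSolvableAt (deMorganFormulaFns f) s m :=
  not_searchMCSPSolvableAt_of_junta hm (deMorganFormulaFns_junta f (2 ^ m)) h

/-- The same for BRANCHING PROGRAMS with `f(2^m)` inner nodes per output bit. [folklore] -/
theorem not_searchMCSPSolvableAt_bp {s f : ℕ → ℕ} {m : ℕ} (hm : 1 ≤ m)
    (h : (s m + 1) * (16 * (m + s m + 1) ^ 2) ^ s m * (m + s m + 1) < 2 ^ (2 ^ m - f (2 ^ m))) :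
    ¬ SearchMCSPSolvableAt (bpFns f) s m :=
  not_searchMCSPSolvableAt_of_junta hm (bpFns_junta f (2 ^ m)) h

/-- The count condition at the budget `N - ⌈N^{β'}⌉`, eventually, whenever eventually
`s(m) ≤ ⌈2^{βm}⌉` with `0 ≤ β < β' < 1`. [folklore] -/
theorem eventually_circuitCount_lt_two_pow_sub_sublinear {s : ℕ → ℕ} {β β' : ℝ} (hβ : 0 ≤ β)
    (hββ' : β < β') (hβ'1 : β' < 1)
    (hs : ∀ᶠ m : ℕ in atTop, s m ≤ OliveiraPichSanthanam2019.noBound β m) :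
    ∀ᶠ m : ℕ in atTop, (s m + 1) * (16 * (m + s m + 1) ^ 2) ^ s m * (m + s m + 1) <
      2 ^ (2 ^ m - (2 ^ m - ⌈((2 ^ m : ℕ) : ℝ) ^ β'⌉₊)) := by
  filter_upwards [eventually_circuitCount_noBound_lt hβ hββ' hβ'1, hs] with m hm hsm
  exact ((circuitCount_mono m hsm).trans_lt hm).trans_le
    (Nat.pow_le_pow_right (by norm_num) (Nat.sub_le _ 1))

/-- **Item 3, KNOWN side in the same model.** For every `s` in the regime of Thm. 1.6 there is
`β₀ < 1` such that for every `β' ∈ (β₀, 1)`, `search-MCSP[s]` is not solved with `N - ⌈N^{β'}⌉`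
`B₂`-formula LEAVES per output bit at any large `m` (item 3 needs `N² · s(m)^k + k` for every `k`).
[cite: ChenJinWilliams2019, Thm. 1.6 item 3 (hypothesis shape; known side folklore)] -/
theorem searchMCSP_b2Formula_known_sublinear {s : ℕ → ℕ} (hs : SizeRegime s) :
    ∃ β₀ : ℝ, β₀ < 1 ∧ ∀ β' : ℝ, β₀ < β' → β' < 1 → ∀ᶠ m : ℕ in atTop,
      ¬ SearchMCSPSolvableAt (b2FormulaFns fun N => N - ⌈(N : ℝ) ^ β'⌉₊) s m := by
  obtain ⟨β, hβ0, hβ1, hev⟩ := hs.exists_eventually_le_noBound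
  refine ⟨β, hβ1, fun β' hββ' hβ'1 => ?_⟩
  filter_upwards [eventually_circuitCount_lt_two_pow_sub_sublinear hβ0 hββ' hβ'1 hev,
    eventually_ge_atTop 1] with m hm hm1
  exact not_searchMCSPSolvableAt_b2Formula hm1 hm

/-- **Item 4, the light-cone cell** (weaker than print's `N^{2-δ}` for De Morgan formulas, recorded
for uniformity): `N - ⌈N^{β'}⌉` De Morgan LEAVES per output bit do not suffice, every large `m`.
[cite: ChenJinWilliams2019, Thm. 1.6 item 4 (hypothesis shape; known side folklore)] -/
theorem searchMCSP_formula_known_sublinear {s : ℕ → ℕ} (hs : SizeRegime s) :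
    ∃ β₀ : ℝ, β₀ < 1 ∧ ∀ β' : ℝ, β₀ < β' → β' < 1 → ∀ᶠ m : ℕ in atTop,
      ¬ SearchMCSPSolvableAt (deMorganFormulaFns fun N => N - ⌈(N : ℝ) ^ β'⌉₊) s m := by
  obtain ⟨β, hβ0, hβ1, hev⟩ := hs.exists_eventually_le_noBound
  refine ⟨β, hβ1, fun β' hββ' hβ'1 => ?_⟩
  filter_upwards [eventually_circuitCount_lt_two_pow_sub_sublinear hβ0 hββ' hβ'1 hev,
    eventually_ge_atTop 1] with m hm hm1
  exact not_searchMCSPSolvableAt_formula hm1 hm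

/-- **Item 5, KNOWN side in the same model.** For every `s` in the regime there is `β₀ < 1` such
that for every `β' ∈ (β₀, 1)`, `search-MCSP[s]` is not solved by branching programs with
`N - ⌈N^{β'}⌉` inner nodes per output bit at any large `m` (item 5 needs `N² · s(m)^k + k` for
every `k`). [cite: ChenJinWilliams2019, Thm. 1.6 item 5 (hypothesis shape; known side folklore)] -/
theorem searchMCSP_bp_known_sublinear {s : ℕ → ℕ} (hs : SizeRegime s) :
    ∃ β₀ : ℝ, β₀ < 1 ∧ ∀ β' : ℝ, β₀ < β' → β' < 1 → ∀ᶠ m : ℕ in atTop,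
      ¬ SearchMCSPSolvableAt (bpFns fun N => N - ⌈(N : ℝ) ^ β'⌉₊) s m := by
  obtain ⟨β, hβ0, hβ1, hev⟩ := hs.exists_eventually_le_noBound
  refine ⟨β, hβ1, fun β' hββ' hβ'1 => ?_⟩
  filter_upwards [eventually_circuitCount_lt_two_pow_sub_sublinear hβ0 hββ' hβ'1 hev,
    eventually_ge_atTop 1] with m hm hm1
  exact not_searchMCSPSolvableAt_bp hm1 hm

/-- The KNOWN and NEEDED budgets of items 3/5 (and a fortiori item 4) never cross:
`N - ⌈N^{β'}⌉ < N² · s^k + k` for `1 ≤ s`, `1 ≤ N`. [folklore] -/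
theorem searchKnown_lt_needed_sq {N s : ℕ} (hN : 1 ≤ N) (hs : 1 ≤ s) (k : ℕ) (β' : ℝ) :
    N - ⌈(N : ℝ) ^ β'⌉₊ < N ^ 2 * s ^ k + k := by
  have h := knownBudget_lt_searchBudget hN hs k β'
  have h2 : N * s ^ k ≤ N ^ 2 * s ^ k := Nat.mul_le_mul_right _ (by nlinarith)
  omega

end Literature.Computability.MetaComplexity.ChenJinWilliams2019
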